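import Summits.QuantumFields.QCD.Theorems.QuarksAsStableActionStableActionBridgeStableMajorant
import Literature.MathematicalPhysics.QuantumFieldTheory.LatticeGaugeProofs

/-!
# `WilsonQuarkStability` at the MEASURE level: domination of the unquenched `N_f`-flavour weight
(crux `QuarksAsStableAction.StableActionBridge`, item stmt-QuantumFields-9737, line `Sketch`;
registered stubs `prod_stableMajorant_of_wilsonQuarkStability` and `unquenched_weight_domination`)

The route's stability crux S = `WilsonQuarkStability`, through the landed single-flavour stable
majorant `stableMajorant_of_wilsonQuarkStability`
(`‖det D_AP[U, m]‖ ≤ exp(K + c · S_W(U)) · ‖det D_AP[𝟙, m]‖` for `|m| ≤ ε`, `L ≥ L₀`, with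
`S_W = wilsonAction (fundamentalRep (Fin 3))` the full Wilson action), is consumed at the level of
the unquenched lattice-QCD measure, whose weight relative to the Wilson measure `μ_{W,β}` is the
product `∏_f det D_AP[U, m_f]` over the `N_f` flavours:

* `prod_stableMajorant_of_wilsonQuarkStability` — the product over flavours of the one-flavour
  bound (nonnegative factors, `Finset.prod_le_prod`), with constants made nonnegative
  (`c ↦ max c 0`, `K ↦ max K 0`, legitimate because `S_W ≥ 0` for the unitary fundamental
  representation): `‖∏_f det D_AP[U, m_f]‖ ≤ exp(N_f (K + c · S_W(U))) · ∏_f ‖det D_AP[𝟙, m_f]‖`;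
* `unquenched_weight_domination` — integrating against a measurable test function `0 ≤ F ≤ 1`:
  the unquenched weight is dominated by the quenched Wilson weight tilted by `exp(N_f c · S_W)`
  (i.e. at shifted coupling),
  `∫ F ‖∏_f det‖ dμ_{W,β} ≤ exp(N_f K) (∏_f ‖det D_AP[𝟙, m_f]‖) ∫ F exp(N_f c S_W) dμ_{W,β}`
  (`integral_mono_of_nonneg`; the right integrand is bounded, `S_W ≤ 6 · #plaquettes`, on the
  probability space `μ_{W,β}`, hence integrable).

Elementary bookkeeping and monotonicity of the integral; CONDITIONAL on `WilsonQuarkStability`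
(item stmt-QuantumFields-9736, open), taken as the hypothesis of both statements.
-/

namespace Summit.QuantumFields.QCD.Cruxes.StableActionBridge.Sketch

open MeasureTheory Literature.MathematicalPhysics.QuantumFieldTheory
  Literature.MathematicalPhysics.QuantumLattice
open Summit.QuantumFields.QCD.Theses.QuarksAsStableAction (WilsonQuarkStability)

/-- `|Re tr U| ≤ 3` for `U ∈ SU(3)` in the fundamental representation (unitary entries have
modulus `≤ 1`). [folklore] -/
private theorem abs_re_trace_rho3_le_three (g : Matrix.specialUnitaryGroup (Fin 3) ℂ) :
    |((fundamentalRep (Fin 3)) g).trace.re| ≤ 3 := by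
  -- adapted from `re_trace_rho3_le_three` in
  -- `Summits.QuantumFields.QCD.Theorems.QuarksAsStableActionStableActionBridgeStableMajorant`
  have hU := fundamentalRep_mem_unitaryGroup g
  rw [Matrix.trace, Complex.re_sum]
  calc |∑ a, (Matrix.diag ((fundamentalRep (Fin 3)) g) a).re|
      ≤ ∑ a, |(Matrix.diag ((fundamentalRep (Fin 3)) g) a).re| := Finset.abs_sum_le_sum_abs _ _
    _ ≤ ∑ _a : Fin 3, (1 : ℝ) := Finset.sum_le_sum fun a _ =>
        (Complex.abs_re_le_norm _).trans (entry_norm_bound_of_unitary hU a a)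
    _ = 3 := by simp

/-- Every plaquette deficit `3 − Re tr U_p` of an `SU(3)` gauge field (fundamental representation)
lies in `[0, 6]`. [folklore] -/
private theorem deficit_rho3_mem {L : ℕ}
    (U : GaugeConfig 4 L (Matrix.specialUnitaryGroup (Fin 3) ℂ)) (p : Plaquette 4 L) :
    0 ≤ 3 - ((fundamentalRep (Fin 3)) (plaquetteHolonomy U p.1 p.2.1.1 p.2.1.2)).trace.re ∧
      3 - ((fundamentalRep (Fin 3)) (plaquetteHolonomy U p.1 p.2.1.1 p.2.1.2)).trace.re ≤ 6 := by
  have h := abs_le.1 (abs_re_trace_rho3_le_three (plaquetteHolonomy U p.1 p.2.1.1 p.2.1.2))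
  constructor <;> linarith [h.1, h.2]

/-- The `SU(3)` Wilson action (fundamental representation) is nonnegative and at most `6` per
plaquette. [folklore] -/
private theorem wilsonAction_rho3_mem {L : ℕ} [NeZero L]
    (U : GaugeConfig 4 L (Matrix.specialUnitaryGroup (Fin 3) ℂ)) :
    0 ≤ wilsonAction (fundamentalRep (Fin 3)) U ∧
      wilsonAction (fundamentalRep (Fin 3)) U ≤ 6 * Fintype.card (Plaquette 4 L) := by
  have hW : wilsonAction (fundamentalRep (Fin 3)) U =
      ∑ p : Plaquette 4 L,
        (3 - ((fundamentalRep (Fin 3)) (plaquetteHolonomy U p.1 p.2.1.1 p.2.1.2)).trace.re) := by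
    simp only [wilsonAction, Nat.cast_ofNat]
  rw [hW]
  refine ⟨Finset.sum_nonneg fun p _ => (deficit_rho3_mem U p).1, ?_⟩
  calc ∑ p : Plaquette 4 L,
        (3 - ((fundamentalRep (Fin 3)) (plaquetteHolonomy U p.1 p.2.1.1 p.2.1.2)).trace.re)
      ≤ ∑ _p : Plaquette 4 L, (6 : ℝ) := Finset.sum_le_sum fun p _ => (deficit_rho3_mem U p).2
    _ = 6 * Fintype.card (Plaquette 4 L) := by
        rw [Finset.sum_const, Finset.card_univ, nsmul_eq_mul, mul_comm]

/-- **Product stable majorant** (`N_f` flavours): if the antiperiodic Wilson-quark determinant obeys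
the route's stability bound S, then there are `ε > 0`, NONNEGATIVE `c, K` and `L₀` such that for all
`L ≥ L₀`, every number of flavours `N_f`, all bare masses `|m_f| ≤ ε` and every `SU(3)` gauge field
`U`, `‖∏_f det D_AP[U, m_f]‖ ≤ exp(N_f · (K + c · S_W(U))) · ∏_f ‖det D_AP[𝟙, m_f]‖` — the product
over flavours of `stableMajorant_of_wilsonQuarkStability` (with its `c, K` replaced by `max c 0`,
`max K 0`, legitimate since `S_W ≥ 0`).  CONDITIONAL on `WilsonQuarkStability`, the hypothesis.
[folklore] -/
theorem prod_stableMajorant_of_wilsonQuarkStability :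
    WilsonQuarkStability → ∃ ε c K : ℝ, 0 < ε ∧ 0 ≤ c ∧ 0 ≤ K ∧ ∃ L₀ : ℕ, ∀ (L : ℕ) [NeZero L],
      L₀ ≤ L →
      let apDet : GaugeConfig 4 L (Matrix.specialUnitaryGroup (Fin 3) ℂ) → ℝ → ℂ := fun U m =>
        fermionDet (wilsonDirac (unitaryFundamentalRep (Fin 3) ℂ)
          (fun e => if e.1 e.2 = -1
            then -(⟨(U e).1, Matrix.specialUnitaryGroup_le_unitaryGroup (U e).2⟩ :
              Matrix.unitaryGroup (Fin 3) ℂ)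
            else ⟨(U e).1, Matrix.specialUnitaryGroup_le_unitaryGroup (U e).2⟩) m 1);
      ∀ (Nf : ℕ) (m : Fin Nf → ℝ), (∀ f, |m f| ≤ ε) →
        ∀ U : GaugeConfig 4 L (Matrix.specialUnitaryGroup (Fin 3) ℂ),
          ‖∏ f, apDet U (m f)‖ ≤
            Real.exp ((Nf : ℝ) * (K + c * wilsonAction (fundamentalRep (Fin 3)) U)) *
              ∏ f, ‖apDet 1 (m f)‖ := by
  intro hS
  obtain ⟨ε, c, K, hε, L₀, h⟩ := stableMajorant_of_wilsonQuarkStability hS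
  refine ⟨ε, max c 0, max K 0, hε, le_max_right _ _, le_max_right _ _, L₀, fun L _ hL => ?_⟩
  intro apDet Nf m hm U
  have hW : 0 ≤ wilsonAction (fundamentalRep (Fin 3)) U := (wilsonAction_rho3_mem U).1
  have h1 : ∀ f, ‖apDet U (m f)‖ ≤
      Real.exp (max K 0 + max c 0 * wilsonAction (fundamentalRep (Fin 3)) U) * ‖apDet 1 (m f)‖ :=
    fun f => (h L hL (m f) (hm f) U).trans (mul_le_mul_of_nonneg_right (Real.exp_le_exp.2
      (add_le_add (le_max_left _ _) (mul_le_mul_of_nonneg_right (le_max_left _ _) hW)))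
      (norm_nonneg _))
  calc ‖∏ f, apDet U (m f)‖ = ∏ f, ‖apDet U (m f)‖ := norm_prod _ _
    _ ≤ ∏ f, Real.exp (max K 0 + max c 0 * wilsonAction (fundamentalRep (Fin 3)) U) *
          ‖apDet 1 (m f)‖ := Finset.prod_le_prod (fun f _ => norm_nonneg _) fun f _ => h1 f
    _ = Real.exp ((Nf : ℝ) * (max K 0 + max c 0 * wilsonAction (fundamentalRep (Fin 3)) U)) *
          ∏ f, ‖apDet 1 (m f)‖ := by
        rw [Finset.prod_mul_distrib, Finset.prod_const, Finset.card_univ, Fintype.card_fin,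
          Real.exp_nat_mul]

/-- **Unquenched weight domination** (S at the measure level): with the constants of
`prod_stableMajorant_of_wilsonQuarkStability`, for all `L ≥ L₀`, all `N_f`, all bare masses
`|m_f| ≤ ε`, every inverse coupling `β` and every measurable test function `0 ≤ F ≤ 1` on `SU(3)`
gauge fields, `∫ F · ‖∏_f det D_AP[U, m_f]‖ dμ_{W,β} ≤ exp(N_f K) · (∏_f ‖det D_AP[𝟙, m_f]‖) ·
∫ F · exp(N_f c · S_W) dμ_{W,β}`: the `N_f`-flavour unquenched weight is dominated by the quenched
Wilson weight tilted by `exp(N_f c · S_W)` (monotonicity of the integral against the Wilson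
probability measure; the tilted integrand is bounded, hence integrable).  CONDITIONAL on
`WilsonQuarkStability`, the hypothesis. [folklore] -/
theorem unquenched_weight_domination :
    WilsonQuarkStability → ∃ ε c K : ℝ, 0 < ε ∧ 0 ≤ c ∧ 0 ≤ K ∧ ∃ L₀ : ℕ, ∀ (L : ℕ) [NeZero L],
      L₀ ≤ L →
      let apDet : GaugeConfig 4 L (Matrix.specialUnitaryGroup (Fin 3) ℂ) → ℝ → ℂ := fun U m =>
        fermionDet (wilsonDirac (unitaryFundamentalRep (Fin 3) ℂ)
          (fun e => if e.1 e.2 = -1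
            then -(⟨(U e).1, Matrix.specialUnitaryGroup_le_unitaryGroup (U e).2⟩ :
              Matrix.unitaryGroup (Fin 3) ℂ)
            else ⟨(U e).1, Matrix.specialUnitaryGroup_le_unitaryGroup (U e).2⟩) m 1);
      ∀ (Nf : ℕ) (m : Fin Nf → ℝ), (∀ f, |m f| ≤ ε) →
        ∀ (β : ℝ) (F : GaugeConfig 4 L (Matrix.specialUnitaryGroup (Fin 3) ℂ) → ℝ),
          Measurable F → (∀ U, 0 ≤ F U) → (∀ U, F U ≤ 1) →
            ∫ U, F U * ‖∏ f, apDet U (m f)‖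
                ∂(wilsonMeasure (d := 4) (L := L) (fundamentalRep (Fin 3)) β) ≤
              Real.exp ((Nf : ℝ) * K) * (∏ f, ‖apDet 1 (m f)‖) *
                ∫ U, F U * Real.exp ((Nf : ℝ) * c * wilsonAction (fundamentalRep (Fin 3)) U)
                  ∂(wilsonMeasure (d := 4) (L := L) (fundamentalRep (Fin 3)) β) := by
  intro hS
  obtain ⟨ε, c, K, hε, hc, hK, L₀, h⟩ := prod_stableMajorant_of_wilsonQuarkStability hS
  refine ⟨ε, c, K, hε, hc, hK, L₀, fun L _ hL => ?_⟩
  intro apDet Nf m hm β F hF hF0 hF1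
  have hpt : ∀ U : GaugeConfig 4 L (Matrix.specialUnitaryGroup (Fin 3) ℂ), ‖∏ f, apDet U (m f)‖ ≤
      Real.exp ((Nf : ℝ) * (K + c * wilsonAction (fundamentalRep (Fin 3)) U)) *
        ∏ f, ‖apDet 1 (m f)‖ := h L hL Nf m hm
  set μ : Measure (GaugeConfig 4 L (Matrix.specialUnitaryGroup (Fin 3) ℂ)) :=
    wilsonMeasure (d := 4) (L := L) (fundamentalRep (Fin 3)) β with hμ
  haveI : IsProbabilityMeasure μ :=
    isProbabilityMeasure_wilsonMeasure _ (continuous_fundamentalRep (Fin 3)) β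
  set A : ℝ := ∏ f, ‖apDet 1 (m f)‖ with hA
  set S : GaugeConfig 4 L (Matrix.specialUnitaryGroup (Fin 3) ℂ) → ℝ :=
    wilsonAction (fundamentalRep (Fin 3)) with hS_def
  -- the tilted quenched integrand is measurable and bounded on a probability space, hence integrable
  have hmeas : Measurable fun U => F U * Real.exp ((Nf : ℝ) * c * S U) :=
    hF.mul (Real.measurable_exp.comp
      ((measurable_wilsonAction _ (continuous_fundamentalRep (Fin 3))).const_mul _))
  have hint : Integrable (fun U => F U * Real.exp ((Nf : ℝ) * c * S U)) μ := by
    refine Integrable.of_bound hmeas.aestronglyMeasurable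
      (Real.exp ((Nf : ℝ) * c * (6 * Fintype.card (Plaquette 4 L))))
      (Filter.Eventually.of_forall fun U => ?_)
    rw [Real.norm_eq_abs, abs_of_nonneg (mul_nonneg (hF0 U) (Real.exp_nonneg _))]
    calc F U * Real.exp ((Nf : ℝ) * c * S U) ≤ 1 * Real.exp ((Nf : ℝ) * c * S U) :=
          mul_le_mul_of_nonneg_right (hF1 U) (Real.exp_nonneg _)
      _ ≤ Real.exp ((Nf : ℝ) * c * (6 * Fintype.card (Plaquette 4 L))) := by
          rw [one_mul]
          exact Real.exp_le_exp.2 (mul_le_mul_of_nonneg_left (wilsonAction_rho3_mem U).2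
            (mul_nonneg (Nat.cast_nonneg _) hc))
  calc ∫ U, F U * ‖∏ f, apDet U (m f)‖ ∂μ
      ≤ ∫ U, Real.exp ((Nf : ℝ) * K) * A * (F U * Real.exp ((Nf : ℝ) * c * S U)) ∂μ := by
        refine integral_mono_of_nonneg
          (Filter.Eventually.of_forall fun U => mul_nonneg (hF0 U) (norm_nonneg _))
          (hint.const_mul _) (Filter.Eventually.of_forall fun U => ?_)
        calc F U * ‖∏ f, apDet U (m f)‖
            ≤ F U * (Real.exp ((Nf : ℝ) * (K + c * S U)) * A) :=
              mul_le_mul_of_nonneg_left (hpt U) (hF0 U)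
          _ = Real.exp ((Nf : ℝ) * K) * A * (F U * Real.exp ((Nf : ℝ) * c * S U)) := by
              rw [mul_add, Real.exp_add, ← mul_assoc (Nf : ℝ) c]
              ring
    _ = Real.exp ((Nf : ℝ) * K) * A * ∫ U, F U * Real.exp ((Nf : ℝ) * c * S U) ∂μ :=
        integral_const_mul _ _

end Summit.QuantumFields.QCD.Cruxes.StableActionBridge.Sketch
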